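import Summits.QuantumFields.BalabanUV.Beta.FP.TowerK2bDoorTadpoleZerothMoment

/-!
# `BalabanUV.Beta.FP.TowerK2bDoorTadpoleMoments` — binder row D1 ∕ (C1) OWNER «beta-an2», PART 41: **THE LATTICE MOMENTS OF A COVARIANT SYMMETRISED DOOR
# PAIRING ARE BILINEAR IN THE MOMENTS OF ITS TWO FACTORS** — on an infinite lattice with finitely supported columns (no wrap-around), the weighted sum
# `Σ_z ω(z)·X((μ,0),(ν,z))` is a window double sum against `ω(y − w)`; for `ω = 1`, an additive coordinate `c`, or a product `c·c′` this expresses an4's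
# `hD0 ∕ hD1 ∕ hD2` rows (SPEC-64 §10 (ii-A″); G2-M2′'s folds M0∕M1∕M2, requests.jsonl l.4525) through the zeroth∕first∕second moments of the read-out columns
# `Ŝ` and of the door-word columns `τ(λ)`; under PART 40's letter (no door word on the summed gauge column) the first moment on the DIAGONAL source pairs
# vanishes identically and the second moment is `M0(Ŝ)·M2(τ) − M1(Ŝ)⊗M1(τ)` symmetrised

WHY.  PART 40 (`TowerK2bDoorTadpoleZerothMoment`) folds the ZEROTH moment on a finite torus.  First and second moments weigh `z` by coordinates, which are
additive on the LATTICE `ℤ⁴` but not on a torus (SPEC-64 §10 (3′): wrapped moments are representative-dependent; hence G2-M2′ at p = 7 and its containment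
gate `C7`).  THIS FILE does the lattice bookkeeping once, hypothesis-free up to DISPLAYED finite supports: windows `W` (columns) and `Z ∋ y − w` (relative
positions), over ANY additive commutative group `G`:
§1 **`sum_window_crossCorrelation`** — `Σ_{z∈Z} ω z·Σ_{y∈W} f(y−z)·g(y) = Σ_{y∈W} Σ_{w∈W} ω(y−w)·(f w·g y)` for `f` supported in `W` (reindex `w = y − z`, `Finset.sum_image`
   + `Finset.sum_subset`); **`symPairing_eq_zero_of_not_mem`** — the pairing vanishes off `Z`;
§2 **`weightedSum_symPairing_eq`** — the MASTER IDENTITY for any weight `ω`; **`latticeZerothMoment_symPairing_eq`** (`ω = 1`: PART 40 §1's shape on the lattice) and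
   `…_eq_zero` under `hΘ : ∀ κ μ, Σ_{y∈W} τ_{(κ,y)}(λ_{(μ,0)}) = 0`;
§3 **`latticeFirstMoment_symPairing_eq`** (`ω = c`, `c : G →+ ℝ`): four products of zeroth and first column moments; under `hΘ`:
   `Σ_z c z·X = Σ_κ (M0Ŝ_ν(κ)·M1τ_μ(κ) − M0Ŝ_μ(κ)·M1τ_ν(κ))` (**`…_of_colSum_eq_zero`**), ANTISYMMETRIC in `(μ,ν)`, hence **`latticeFirstMoment_symPairing_diag_eq_zero`**:
   an4's `hD1` on the diagonal source pairs `μ = ν` is AUTOMATIC from `hD0`'s letter;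
§4 **`latticeSecondMoment_symPairing_eq_of_colSum_eq_zero`** (`ω = c·c′`): under `hΘ`,
   `Σ_z c z·c′ z·X = Σ_κ (M0Ŝ_ν·M2τ_μ + M0Ŝ_μ·M2τ_ν − M1^cτ_μ·M1^{c′}Ŝ_ν − M1^{c′}τ_μ·M1^{c}Ŝ_ν − M1^{c}Ŝ_μ·M1^{c′}τ_ν − M1^{c′}Ŝ_μ·M1^{c}τ_ν)(κ)` — WHAT G2-M2′ MEASURES,
   factor by factor: the door tadpole's second moment is visible exactly insofar as (read-out column sums) × (second moments of ONE gauge column's door words) and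
   the first-moment cross terms do not cancel; **`…_of_colSums_eq_zero`** — if ALSO the read-out columns sum to zero (`hS0`) it is PURELY DIPOLE × DIPOLE,
   `−Σ_κ (M1Ŝ ⊗ M1τ + sym)`, and on the diagonal pair against `c²`: `−4·Σ_κ M1^cŜ_μ(κ)·M1^cτ_μ(κ)` (**`…_diag_sq_eq_of_colSums_eq_zero`**);
§5 **`hasSum_weighted_symPairing`** — the `HasSum` twins on `G` (`hasSum_sum_of_ne_finset_zero`), incl. **`hasSum_firstMoment_symPairing_diag`** `= 0`.
READING (zero weight; nothing asserted about the record): these identities are the row's tool for READING Engine C's K2L-M2P7 deposit (p = 7, `TAU` + `wPhi9`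
persisted): which factor carries a visible `(κ,κ;μ,μ)` or read-out-line component.  [folklore] `Finset` algebra BY NAME over an abstract additive commutative
group; no `def`, no `def … : Prop`, nothing cited, 0 sorry; imports PART 40 only.  Nothing of Bałaban's asserted, valued or discharged; `hD0 ∕ hD1 ∕ hD2 ∕ hDF`
NOT discharged at the record's letters (supports, covariance and `hΘ` are DISPLAYED); `hDΔ ∕ hDΔtr ∕ D1Tel` NOT claimed either way; (J-R₂″) NOT claimed;
0∕4 row-D1 binders (hW ∕ hR ∕ D1Tel ∕ D1Rep); NOT (C1), NOT (T-ID), NOT D1, NEVER «G-an2-4 closed», NOT BetaPertH, NOT continuum, NOT Clay.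
HONEST DEPENDENCY (page 1, mandatory): continuum YM on T⁴ ⇐ BetaPertH ∧ nine spine estimates (0/9 proved); BetaPertH ⇐ (D1) ∧ (D4) ∧ CAP+tail;
G-an2-4 gates asym, D1 and NE2/3/4.  HONEST FRAMING (cell contract, verbatim): «discharging `BetaPertH` makes Bałaban's UV stability UNCONDITIONAL —
a real constructive-QFT result; it is NOT the continuum limit and NOT the Clay problem.»  ABSOLUTE RULE (cell charter, verbatim): «No internally-minted
statement may enter as a cited fact. Every hypothesis is either kernel-proved in this package or a verbatim quotation of a PUBLISHED theorem with page
reference. The manuscript(s) under audit are NOT citable for their own disputed steps — they are the thing under adjudication; programme-internal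
(2001/route/tribunal) claims are never citable.»  Row D1 ∕ (C1) OWNER, b2b-balaban-beta-an2 gen 75, 2026-08-28.  No existing file touched.
-/

noncomputable section

open scoped BigOperators

namespace Summit.QuantumFields.BalabanUV.Beta.FP.TowerK2bDoorTadpoleMoments

open Finset

variable {D G V : Type*} [Fintype D] [AddCommGroup G] [DecidableEq G] [AddCommGroup V] [Module ℝ V]

/-! ## §1 Window cross-correlations on a lattice: reindexing by the relative position -/

omit [Fintype D] [AddCommGroup V] [Module ℝ V] in
/-- [folklore] **`sum_window_crossCorrelation`**: for columns `f`, `g` with `f` supported in the window `W`, a set of relative positions `Z` containing every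
difference `y − w` of window points, and any weight `ω`:  `Σ_{z∈Z} ω z·Σ_{y∈W} f(y − z)·g y = Σ_{y∈W} Σ_{w∈W} ω(y − w)·(f w·g y)`. -/
theorem sum_window_crossCorrelation (W Z : Finset G) (hZ : ∀ y ∈ W, ∀ w ∈ W, y - w ∈ Z) (f g : G → ℝ) (hf : ∀ w, w ∉ W → f w = 0) (ω : G → ℝ) :
    ∑ z ∈ Z, ω z * ∑ y ∈ W, f (y - z) * g y = ∑ y ∈ W, ∑ w ∈ W, ω (y - w) * (f w * g y) := by
  simp only [Finset.mul_sum]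
  rw [Finset.sum_comm]
  refine Finset.sum_congr rfl fun y hy => ?_
  have hinj : Set.InjOn (fun z : G => y - z) (Z : Set G) := fun a _ b _ (h : y - a = y - b) => sub_right_injective h
  have h1 : ∑ z ∈ Z, ω z * (f (y - z) * g y) = ∑ w ∈ Z.image (fun z => y - z), ω (y - w) * (f w * g y) := by
    rw [Finset.sum_image hinj]
    exact Finset.sum_congr rfl fun z _ => by rw [sub_sub_cancel]
  rw [h1]
  symm
  refine Finset.sum_subset (fun w hw => Finset.mem_image.mpr ⟨y - w, hZ y hy w hw, sub_sub_cancel y w⟩) fun w _ hw => ?_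
  rw [hf w hw, zero_mul, mul_zero]

omit [DecidableEq G] in
/-- [folklore] **`symPairing_eq_zero_of_not_mem`**: with read-out columns `Ŝ_{(ν,0)}(κ,·)` and door-word columns `y ↦ τ_{(κ,y)}(λ_{(μ,0)})` supported in `W`, both
families covariant (`S ν z κ y = S ν 0 κ (y − z)`, `τ_{(κ,y)}(λ_{(μ,z)}) = τ_{(κ,y−z)}(λ_{(μ,0)})`), the window pairing
`X((μ,0),(ν,z)) := Σ_κ Σ_{y∈W} (S ν z κ y·τ_{(κ,y)}(λ_{(μ,0)}) + S μ 0 κ y·τ_{(κ,y)}(λ_{(ν,z)}))` VANISHES for every relative position `z ∉ Z`. -/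
theorem symPairing_eq_zero_of_not_mem (W Z : Finset G) (hZ : ∀ y ∈ W, ∀ w ∈ W, y - w ∈ Z)
    (S : D → G → D → G → ℝ) (tau : D → G → V →ₗ[ℝ] ℝ) (lam : D → G → V)
    (hS : ∀ (ν : D) (z : G) (κ : D) (y : G), S ν z κ y = S ν 0 κ (y - z))
    (hτ : ∀ (κ : D) (y : G) (μ : D) (z : G), tau κ y (lam μ z) = tau κ (y - z) (lam μ 0))
    (hSW : ∀ (ν κ : D) (w : G), w ∉ W → S ν 0 κ w = 0) (hτW : ∀ (κ μ : D) (w : G), w ∉ W → tau κ w (lam μ 0) = 0)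
    (μ ν : D) (z : G) (hz : z ∉ Z) :
    ∑ κ, ∑ y ∈ W, (S ν z κ y * tau κ y (lam μ 0) + S μ 0 κ y * tau κ y (lam ν z)) = 0 := by
  refine Finset.sum_eq_zero fun κ _ => Finset.sum_eq_zero fun y hy => ?_
  have hyz : y - z ∉ W := fun h => hz (by simpa using hZ y hy (y - z) h)
  rw [hS ν z κ y, hτ κ y ν z, hSW ν κ _ hyz, hτW κ ν _ hyz, zero_mul, mul_zero, add_zero]

/-! ## §2 The master identity and the zeroth moment on the lattice -/

/-- [folklore] **`weightedSum_symPairing_eq` — THE MASTER IDENTITY**: under the letters of `symPairing_eq_zero_of_not_mem`, for ANY weight `ω : G → ℝ`,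
`Σ_{z∈Z} ω z·X((μ,0),(ν,z)) = Σ_κ (Σ_{y∈W} Σ_{w∈W} ω(y−w)·(S ν 0 κ w·τ_{(κ,y)}(λ_{(μ,0)})) + Σ_{y∈W} Σ_{w∈W} ω(y−w)·(τ_{(κ,w)}(λ_{(ν,0)})·S μ 0 κ y))` —
each half a window double sum against `ω` of the relative position. -/
theorem weightedSum_symPairing_eq (W Z : Finset G) (hZ : ∀ y ∈ W, ∀ w ∈ W, y - w ∈ Z)
    (S : D → G → D → G → ℝ) (tau : D → G → V →ₗ[ℝ] ℝ) (lam : D → G → V)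
    (hS : ∀ (ν : D) (z : G) (κ : D) (y : G), S ν z κ y = S ν 0 κ (y - z))
    (hτ : ∀ (κ : D) (y : G) (μ : D) (z : G), tau κ y (lam μ z) = tau κ (y - z) (lam μ 0))
    (hSW : ∀ (ν κ : D) (w : G), w ∉ W → S ν 0 κ w = 0) (hτW : ∀ (κ μ : D) (w : G), w ∉ W → tau κ w (lam μ 0) = 0)
    (ω : G → ℝ) (μ ν : D) :
    ∑ z ∈ Z, ω z * ∑ κ, ∑ y ∈ W, (S ν z κ y * tau κ y (lam μ 0) + S μ 0 κ y * tau κ y (lam ν z))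
      = ∑ κ, ((∑ y ∈ W, ∑ w ∈ W, ω (y - w) * (S ν 0 κ w * tau κ y (lam μ 0)))
          + ∑ y ∈ W, ∑ w ∈ W, ω (y - w) * (tau κ w (lam ν 0) * S μ 0 κ y)) := by
  have hrew : ∀ z ∈ Z, ω z * ∑ κ, ∑ y ∈ W, (S ν z κ y * tau κ y (lam μ 0) + S μ 0 κ y * tau κ y (lam ν z))
      = ∑ κ, (ω z * ∑ y ∈ W, S ν 0 κ (y - z) * tau κ y (lam μ 0) + ω z * ∑ y ∈ W, tau κ (y - z) (lam ν 0) * S μ 0 κ y) := by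
    intro z _
    rw [Finset.mul_sum]
    refine Finset.sum_congr rfl fun κ _ => ?_
    rw [← mul_add, ← Finset.sum_add_distrib]
    congr 1
    exact Finset.sum_congr rfl fun y _ => by rw [hS ν z κ y, hτ κ y ν z, mul_comm (S μ 0 κ y)]
  rw [Finset.sum_congr rfl hrew, Finset.sum_comm]
  refine Finset.sum_congr rfl fun κ _ => ?_
  rw [Finset.sum_add_distrib, sum_window_crossCorrelation W Z hZ (fun w => S ν 0 κ w) (fun y => tau κ y (lam μ 0)) (hSW ν κ) ω,
    sum_window_crossCorrelation W Z hZ (fun w => tau κ w (lam ν 0)) (fun y => S μ 0 κ y) (hτW κ ν) ω]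

/-- [folklore] **`latticeZerothMoment_symPairing_eq`** (`ω = 1`; PART 40 §1's shape with no wrap-around):
`Σ_{z∈Z} X((μ,0),(ν,z)) = Σ_κ ((Σ_{w∈W} S ν 0 κ w)·(Σ_{y∈W} τ_{(κ,y)}(λ_{(μ,0)})) + (Σ_{y∈W} S μ 0 κ y)·(Σ_{w∈W} τ_{(κ,w)}(λ_{(ν,0)})))`. -/
theorem latticeZerothMoment_symPairing_eq (W Z : Finset G) (hZ : ∀ y ∈ W, ∀ w ∈ W, y - w ∈ Z)
    (S : D → G → D → G → ℝ) (tau : D → G → V →ₗ[ℝ] ℝ) (lam : D → G → V)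
    (hS : ∀ (ν : D) (z : G) (κ : D) (y : G), S ν z κ y = S ν 0 κ (y - z))
    (hτ : ∀ (κ : D) (y : G) (μ : D) (z : G), tau κ y (lam μ z) = tau κ (y - z) (lam μ 0))
    (hSW : ∀ (ν κ : D) (w : G), w ∉ W → S ν 0 κ w = 0) (hτW : ∀ (κ μ : D) (w : G), w ∉ W → tau κ w (lam μ 0) = 0) (μ ν : D) :
    ∑ z ∈ Z, ∑ κ, ∑ y ∈ W, (S ν z κ y * tau κ y (lam μ 0) + S μ 0 κ y * tau κ y (lam ν z))
      = ∑ κ, ((∑ w ∈ W, S ν 0 κ w) * (∑ y ∈ W, tau κ y (lam μ 0)) + (∑ y ∈ W, S μ 0 κ y) * (∑ w ∈ W, tau κ w (lam ν 0))) := by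
  have h := weightedSum_symPairing_eq W Z hZ S tau lam hS hτ hSW hτW (fun _ => (1 : ℝ)) μ ν
  simp only [one_mul] at h
  rw [h]
  refine Finset.sum_congr rfl fun κ _ => ?_
  rw [Finset.sum_mul_sum, Finset.sum_mul_sum]
  congr 1
  · rw [Finset.sum_comm]
  · exact Finset.sum_congr rfl fun y _ => Finset.sum_congr rfl fun w _ => mul_comm _ _

/-- [folklore] **`latticeZerothMoment_symPairing_eq_zero`** — an4's `hD0` SHAPE ON THE LATTICE from ONE displayed letter: if every door-word column sums to
zero (`hΘ : ∀ κ μ, Σ_{y∈W} τ_{(κ,y)}(λ_{(μ,0)}) = 0` — by PART 40 `colSum_eq_apply_translationSum` this is «the translation-summed gauge column has no door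
word»), then `Σ_{z∈Z} X((μ,0),(ν,z)) = 0`. -/
theorem latticeZerothMoment_symPairing_eq_zero (W Z : Finset G) (hZ : ∀ y ∈ W, ∀ w ∈ W, y - w ∈ Z)
    (S : D → G → D → G → ℝ) (tau : D → G → V →ₗ[ℝ] ℝ) (lam : D → G → V)
    (hS : ∀ (ν : D) (z : G) (κ : D) (y : G), S ν z κ y = S ν 0 κ (y - z))
    (hτ : ∀ (κ : D) (y : G) (μ : D) (z : G), tau κ y (lam μ z) = tau κ (y - z) (lam μ 0))
    (hSW : ∀ (ν κ : D) (w : G), w ∉ W → S ν 0 κ w = 0) (hτW : ∀ (κ μ : D) (w : G), w ∉ W → tau κ w (lam μ 0) = 0)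
    (hΘ : ∀ (κ μ : D), ∑ y ∈ W, tau κ y (lam μ 0) = 0) (μ ν : D) :
    ∑ z ∈ Z, ∑ κ, ∑ y ∈ W, (S ν z κ y * tau κ y (lam μ 0) + S μ 0 κ y * tau κ y (lam ν z)) = 0 := by
  rw [latticeZerothMoment_symPairing_eq W Z hZ S tau lam hS hτ hSW hτW μ ν]
  simp only [hΘ, mul_zero, add_zero, Finset.sum_const_zero]

/-! ## §3 The first moment: additive weights -/

/-- [folklore] **`latticeFirstMoment_symPairing_eq`** (`ω = c` ADDITIVE — a lattice coordinate): with the column moments `M0Ŝ_ν(κ) := Σ_w S ν 0 κ w`,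
`M1Ŝ_ν(κ) := Σ_w c w·S ν 0 κ w`, `Θ_μ(κ) := Σ_y τ_{(κ,y)}(λ_{(μ,0)})`, `M1τ_μ(κ) := Σ_y c y·τ_{(κ,y)}(λ_{(μ,0)})`:
`Σ_{z∈Z} c z·X((μ,0),(ν,z)) = Σ_κ (M0Ŝ_ν·M1τ_μ − M1Ŝ_ν·Θ_μ + M1Ŝ_μ·Θ_ν − M0Ŝ_μ·M1τ_ν)(κ)`  (`c(y − w) = c y − c w`). -/
theorem latticeFirstMoment_symPairing_eq (W Z : Finset G) (hZ : ∀ y ∈ W, ∀ w ∈ W, y - w ∈ Z)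
    (S : D → G → D → G → ℝ) (tau : D → G → V →ₗ[ℝ] ℝ) (lam : D → G → V)
    (hS : ∀ (ν : D) (z : G) (κ : D) (y : G), S ν z κ y = S ν 0 κ (y - z))
    (hτ : ∀ (κ : D) (y : G) (μ : D) (z : G), tau κ y (lam μ z) = tau κ (y - z) (lam μ 0))
    (hSW : ∀ (ν κ : D) (w : G), w ∉ W → S ν 0 κ w = 0) (hτW : ∀ (κ μ : D) (w : G), w ∉ W → tau κ w (lam μ 0) = 0)
    (c : G →+ ℝ) (μ ν : D) :
    ∑ z ∈ Z, c z * ∑ κ, ∑ y ∈ W, (S ν z κ y * tau κ y (lam μ 0) + S μ 0 κ y * tau κ y (lam ν z))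
      = ∑ κ, ((∑ w ∈ W, S ν 0 κ w) * (∑ y ∈ W, c y * tau κ y (lam μ 0)) - (∑ w ∈ W, c w * S ν 0 κ w) * (∑ y ∈ W, tau κ y (lam μ 0))
          + (∑ y ∈ W, c y * S μ 0 κ y) * (∑ w ∈ W, tau κ w (lam ν 0)) - (∑ y ∈ W, S μ 0 κ y) * (∑ w ∈ W, c w * tau κ w (lam ν 0))) := by
  rw [weightedSum_symPairing_eq W Z hZ S tau lam hS hτ hSW hτW c μ ν]
  refine Finset.sum_congr rfl fun κ _ => ?_
  simp only [map_sub, sub_mul, Finset.sum_sub_distrib, Finset.sum_mul_sum]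
  have e1 : ∑ y ∈ W, ∑ w ∈ W, c y * (S ν 0 κ w * tau κ y (lam μ 0)) = ∑ w ∈ W, ∑ y ∈ W, S ν 0 κ w * (c y * tau κ y (lam μ 0)) := by
    rw [Finset.sum_comm]; exact Finset.sum_congr rfl fun w _ => Finset.sum_congr rfl fun y _ => by ring
  have e2 : ∑ y ∈ W, ∑ w ∈ W, c w * (S ν 0 κ w * tau κ y (lam μ 0)) = ∑ w ∈ W, ∑ y ∈ W, c w * S ν 0 κ w * tau κ y (lam μ 0) := by
    rw [Finset.sum_comm]; exact Finset.sum_congr rfl fun w _ => Finset.sum_congr rfl fun y _ => by ring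
  have e3 : ∑ y ∈ W, ∑ w ∈ W, c y * (tau κ w (lam ν 0) * S μ 0 κ y) = ∑ y ∈ W, ∑ w ∈ W, c y * S μ 0 κ y * tau κ w (lam ν 0) :=
    Finset.sum_congr rfl fun y _ => Finset.sum_congr rfl fun w _ => by ring
  have e4 : ∑ y ∈ W, ∑ w ∈ W, c w * (tau κ w (lam ν 0) * S μ 0 κ y) = ∑ y ∈ W, ∑ w ∈ W, S μ 0 κ y * (c w * tau κ w (lam ν 0)) :=
    Finset.sum_congr rfl fun y _ => Finset.sum_congr rfl fun w _ => by ring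
  rw [e1, e2, e3, e4]
  ring

/-- [folklore] **`latticeFirstMoment_symPairing_eq_of_colSum_eq_zero`**: under `hΘ` (no door word on the summed gauge columns) the first moment is the
ANTISYMMETRIC combination `Σ_κ (M0Ŝ_ν(κ)·M1τ_μ(κ) − M0Ŝ_μ(κ)·M1τ_ν(κ))`. -/
theorem latticeFirstMoment_symPairing_eq_of_colSum_eq_zero (W Z : Finset G) (hZ : ∀ y ∈ W, ∀ w ∈ W, y - w ∈ Z)
    (S : D → G → D → G → ℝ) (tau : D → G → V →ₗ[ℝ] ℝ) (lam : D → G → V)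
    (hS : ∀ (ν : D) (z : G) (κ : D) (y : G), S ν z κ y = S ν 0 κ (y - z))
    (hτ : ∀ (κ : D) (y : G) (μ : D) (z : G), tau κ y (lam μ z) = tau κ (y - z) (lam μ 0))
    (hSW : ∀ (ν κ : D) (w : G), w ∉ W → S ν 0 κ w = 0) (hτW : ∀ (κ μ : D) (w : G), w ∉ W → tau κ w (lam μ 0) = 0)
    (hΘ : ∀ (κ μ : D), ∑ y ∈ W, tau κ y (lam μ 0) = 0) (c : G →+ ℝ) (μ ν : D) :
    ∑ z ∈ Z, c z * ∑ κ, ∑ y ∈ W, (S ν z κ y * tau κ y (lam μ 0) + S μ 0 κ y * tau κ y (lam ν z))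
      = ∑ κ, ((∑ w ∈ W, S ν 0 κ w) * (∑ y ∈ W, c y * tau κ y (lam μ 0)) - (∑ y ∈ W, S μ 0 κ y) * (∑ w ∈ W, c w * tau κ w (lam ν 0))) := by
  rw [latticeFirstMoment_symPairing_eq W Z hZ S tau lam hS hτ hSW hτW c μ ν]
  refine Finset.sum_congr rfl fun κ _ => ?_
  rw [hΘ κ μ, hΘ κ ν]
  ring

/-- [folklore] **`latticeFirstMoment_symPairing_diag_eq_zero` — an4's `hD1` ON THE DIAGONAL SOURCE PAIRS IS AUTOMATIC**: under `hΘ`, for `μ = ν` the first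
moment of the pairing against ANY additive coordinate vanishes (the two halves are each other's negatives). -/
theorem latticeFirstMoment_symPairing_diag_eq_zero (W Z : Finset G) (hZ : ∀ y ∈ W, ∀ w ∈ W, y - w ∈ Z)
    (S : D → G → D → G → ℝ) (tau : D → G → V →ₗ[ℝ] ℝ) (lam : D → G → V)
    (hS : ∀ (ν : D) (z : G) (κ : D) (y : G), S ν z κ y = S ν 0 κ (y - z))
    (hτ : ∀ (κ : D) (y : G) (μ : D) (z : G), tau κ y (lam μ z) = tau κ (y - z) (lam μ 0))
    (hSW : ∀ (ν κ : D) (w : G), w ∉ W → S ν 0 κ w = 0) (hτW : ∀ (κ μ : D) (w : G), w ∉ W → tau κ w (lam μ 0) = 0)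
    (hΘ : ∀ (κ μ : D), ∑ y ∈ W, tau κ y (lam μ 0) = 0) (c : G →+ ℝ) (μ : D) :
    ∑ z ∈ Z, c z * ∑ κ, ∑ y ∈ W, (S μ z κ y * tau κ y (lam μ 0) + S μ 0 κ y * tau κ y (lam μ z)) = 0 := by
  rw [latticeFirstMoment_symPairing_eq_of_colSum_eq_zero W Z hZ S tau lam hS hτ hSW hτW hΘ c μ μ]
  exact Finset.sum_eq_zero fun κ _ => sub_self _

/-! ## §4 The second moment: products of additive weights -/

/-- [folklore] **`latticeSecondMoment_symPairing_eq_of_colSum_eq_zero` — WHAT G2-M2′ MEASURES, FACTOR BY FACTOR**: under `hΘ`, for two additive coordinates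
`c`, `c′` (the weight `z ↦ c z·c′ z`, i.e. `M2Δ(κ₀,λ₀;μ,ν)` at `c = z_{κ₀}`, `c′ = z_{λ₀}`), with `M2τ_μ(κ) := Σ_y c y·c′ y·τ_{(κ,y)}(λ_{(μ,0)})` and the first
moments `M1^c`, `M1^{c′}` of both columns:
`Σ_z c z·c′ z·X((μ,0),(ν,z)) = Σ_κ (M0Ŝ_ν·M2τ_μ − M1^cŜ_ν·M1^{c′}τ_μ − M1^{c′}Ŝ_ν·M1^{c}τ_μ + M0Ŝ_μ·M2τ_ν − M1^{c}Ŝ_μ·M1^{c′}τ_ν − M1^{c′}Ŝ_μ·M1^{c}τ_ν)(κ)`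
(the `M2Ŝ·Θ` products drop by `hΘ`). -/
theorem latticeSecondMoment_symPairing_eq_of_colSum_eq_zero (W Z : Finset G) (hZ : ∀ y ∈ W, ∀ w ∈ W, y - w ∈ Z)
    (S : D → G → D → G → ℝ) (tau : D → G → V →ₗ[ℝ] ℝ) (lam : D → G → V)
    (hS : ∀ (ν : D) (z : G) (κ : D) (y : G), S ν z κ y = S ν 0 κ (y - z))
    (hτ : ∀ (κ : D) (y : G) (μ : D) (z : G), tau κ y (lam μ z) = tau κ (y - z) (lam μ 0))
    (hSW : ∀ (ν κ : D) (w : G), w ∉ W → S ν 0 κ w = 0) (hτW : ∀ (κ μ : D) (w : G), w ∉ W → tau κ w (lam μ 0) = 0)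
    (hΘ : ∀ (κ μ : D), ∑ y ∈ W, tau κ y (lam μ 0) = 0) (c c' : G →+ ℝ) (μ ν : D) :
    ∑ z ∈ Z, (c z * c' z) * ∑ κ, ∑ y ∈ W, (S ν z κ y * tau κ y (lam μ 0) + S μ 0 κ y * tau κ y (lam ν z))
      = ∑ κ, ((∑ w ∈ W, S ν 0 κ w) * (∑ y ∈ W, c y * c' y * tau κ y (lam μ 0))
              - (∑ w ∈ W, c w * S ν 0 κ w) * (∑ y ∈ W, c' y * tau κ y (lam μ 0))
              - (∑ w ∈ W, c' w * S ν 0 κ w) * (∑ y ∈ W, c y * tau κ y (lam μ 0))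
            + ((∑ y ∈ W, S μ 0 κ y) * (∑ w ∈ W, c w * c' w * tau κ w (lam ν 0))
              - (∑ y ∈ W, c y * S μ 0 κ y) * (∑ w ∈ W, c' w * tau κ w (lam ν 0))
              - (∑ y ∈ W, c' y * S μ 0 κ y) * (∑ w ∈ W, c w * tau κ w (lam ν 0)))) := by
  rw [weightedSum_symPairing_eq W Z hZ S tau lam hS hτ hSW hτW (fun z => c z * c' z) μ ν]
  refine Finset.sum_congr rfl fun κ _ => ?_
  -- expand `c(y−w)·c′(y−w)` and collect; the `c w·c′ w` products pair with the column sums `Θ`, which vanish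
  have hΘμ := hΘ κ μ
  have hΘν := hΘ κ ν
  have key1 : ∑ y ∈ W, ∑ w ∈ W, (c (y - w) * c' (y - w)) * (S ν 0 κ w * tau κ y (lam μ 0))
      = (∑ w ∈ W, S ν 0 κ w) * (∑ y ∈ W, c y * c' y * tau κ y (lam μ 0))
        - (∑ w ∈ W, c w * S ν 0 κ w) * (∑ y ∈ W, c' y * tau κ y (lam μ 0))
        - (∑ w ∈ W, c' w * S ν 0 κ w) * (∑ y ∈ W, c y * tau κ y (lam μ 0))
        + (∑ w ∈ W, c w * c' w * S ν 0 κ w) * (∑ y ∈ W, tau κ y (lam μ 0)) := by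
    simp only [Finset.sum_mul_sum, map_sub]
    rw [Finset.sum_comm]
    simp only [← Finset.sum_sub_distrib, ← Finset.sum_add_distrib]
    exact Finset.sum_congr rfl fun w _ => Finset.sum_congr rfl fun y _ => by ring
  have key2 : ∑ y ∈ W, ∑ w ∈ W, (c (y - w) * c' (y - w)) * (tau κ w (lam ν 0) * S μ 0 κ y)
      = (∑ y ∈ W, S μ 0 κ y) * (∑ w ∈ W, c w * c' w * tau κ w (lam ν 0))
        - (∑ y ∈ W, c y * S μ 0 κ y) * (∑ w ∈ W, c' w * tau κ w (lam ν 0))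
        - (∑ y ∈ W, c' y * S μ 0 κ y) * (∑ w ∈ W, c w * tau κ w (lam ν 0))
        + (∑ y ∈ W, c y * c' y * S μ 0 κ y) * (∑ w ∈ W, tau κ w (lam ν 0)) := by
    simp only [Finset.sum_mul_sum, map_sub]
    simp only [← Finset.sum_sub_distrib, ← Finset.sum_add_distrib]
    exact Finset.sum_congr rfl fun y _ => Finset.sum_congr rfl fun w _ => by ring
  rw [key1, key2, hΘμ, hΘν, mul_zero, mul_zero, add_zero, add_zero]

/-- [folklore] **`latticeSecondMoment_symPairing_eq_of_colSums_eq_zero` — DIPOLE × DIPOLE**: if BOTH factors have vanishing column sums (`hΘ` for the door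
words AND `hS0 : ∀ ν κ, Σ_{w∈W} S ν 0 κ w = 0` for the read-out columns), the second moment of the pairing against `c·c′` is MINUS the symmetrised sum of
products of FIRST moments: `Σ_z c z·c′ z·X = −Σ_κ (M1^cŜ_ν·M1^{c′}τ_μ + M1^{c′}Ŝ_ν·M1^{c}τ_μ + M1^{c}Ŝ_μ·M1^{c′}τ_ν + M1^{c′}Ŝ_μ·M1^{c}τ_ν)(κ)` — no second
moment of either factor enters. -/
theorem latticeSecondMoment_symPairing_eq_of_colSums_eq_zero (W Z : Finset G) (hZ : ∀ y ∈ W, ∀ w ∈ W, y - w ∈ Z)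
    (S : D → G → D → G → ℝ) (tau : D → G → V →ₗ[ℝ] ℝ) (lam : D → G → V)
    (hS : ∀ (ν : D) (z : G) (κ : D) (y : G), S ν z κ y = S ν 0 κ (y - z))
    (hτ : ∀ (κ : D) (y : G) (μ : D) (z : G), tau κ y (lam μ z) = tau κ (y - z) (lam μ 0))
    (hSW : ∀ (ν κ : D) (w : G), w ∉ W → S ν 0 κ w = 0) (hτW : ∀ (κ μ : D) (w : G), w ∉ W → tau κ w (lam μ 0) = 0)
    (hΘ : ∀ (κ μ : D), ∑ y ∈ W, tau κ y (lam μ 0) = 0) (hS0 : ∀ (ν κ : D), ∑ w ∈ W, S ν 0 κ w = 0) (c c' : G →+ ℝ) (μ ν : D) :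
    ∑ z ∈ Z, (c z * c' z) * ∑ κ, ∑ y ∈ W, (S ν z κ y * tau κ y (lam μ 0) + S μ 0 κ y * tau κ y (lam ν z))
      = -∑ κ, ((∑ w ∈ W, c w * S ν 0 κ w) * (∑ y ∈ W, c' y * tau κ y (lam μ 0))
              + (∑ w ∈ W, c' w * S ν 0 κ w) * (∑ y ∈ W, c y * tau κ y (lam μ 0))
              + (∑ y ∈ W, c y * S μ 0 κ y) * (∑ w ∈ W, c' w * tau κ w (lam ν 0))
              + (∑ y ∈ W, c' y * S μ 0 κ y) * (∑ w ∈ W, c w * tau κ w (lam ν 0))) := by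
  rw [latticeSecondMoment_symPairing_eq_of_colSum_eq_zero W Z hZ S tau lam hS hτ hSW hτW hΘ c c' μ ν, ← Finset.sum_neg_distrib]
  refine Finset.sum_congr rfl fun κ _ => ?_
  rw [hS0 ν κ, hS0 μ κ]
  ring

/-- [folklore] **`latticeSecondMoment_symPairing_diag_sq_eq_of_colSums_eq_zero`** — the DIAGONAL source pair against the SQUARE of one coordinate (the
`(κ₀,κ₀;μ,μ)` component of G2-M2′): under `hΘ` and `hS0`, `Σ_z (c z)²·X((μ,0),(μ,z)) = −4·Σ_κ M1^cŜ_μ(κ)·M1^cτ_μ(κ)` — ONE product of dipoles per window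
direction. -/
theorem latticeSecondMoment_symPairing_diag_sq_eq_of_colSums_eq_zero (W Z : Finset G) (hZ : ∀ y ∈ W, ∀ w ∈ W, y - w ∈ Z)
    (S : D → G → D → G → ℝ) (tau : D → G → V →ₗ[ℝ] ℝ) (lam : D → G → V)
    (hS : ∀ (ν : D) (z : G) (κ : D) (y : G), S ν z κ y = S ν 0 κ (y - z))
    (hτ : ∀ (κ : D) (y : G) (μ : D) (z : G), tau κ y (lam μ z) = tau κ (y - z) (lam μ 0))
    (hSW : ∀ (ν κ : D) (w : G), w ∉ W → S ν 0 κ w = 0) (hτW : ∀ (κ μ : D) (w : G), w ∉ W → tau κ w (lam μ 0) = 0)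
    (hΘ : ∀ (κ μ : D), ∑ y ∈ W, tau κ y (lam μ 0) = 0) (hS0 : ∀ (ν κ : D), ∑ w ∈ W, S ν 0 κ w = 0) (c : G →+ ℝ) (μ : D) :
    ∑ z ∈ Z, (c z * c z) * ∑ κ, ∑ y ∈ W, (S μ z κ y * tau κ y (lam μ 0) + S μ 0 κ y * tau κ y (lam μ z))
      = -4 * ∑ κ, (∑ w ∈ W, c w * S μ 0 κ w) * (∑ y ∈ W, c y * tau κ y (lam μ 0)) := by
  rw [latticeSecondMoment_symPairing_eq_of_colSums_eq_zero W Z hZ S tau lam hS hτ hSW hτW hΘ hS0 c c μ μ, neg_eq_neg_one_mul, Finset.mul_sum,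
    Finset.mul_sum]
  exact Finset.sum_congr rfl fun κ _ => by ring

/-! ## §5 `HasSum` twins on the whole group -/

omit [DecidableEq G] in
/-- [folklore] **`hasSum_weighted_symPairing`**: since the pairing vanishes off `Z` (§1), for every weight `ω` the family `z ↦ ω z·X((μ,0),(ν,z))` on the whole
group `G` has sum `Σ_{z∈Z} ω z·X` (`hasSum_sum_of_ne_finset_zero`) — the bridge from the window folds of §2–§4 to an4's `HasSum … 0` ∕ `∑' … = 0` rows. -/
theorem hasSum_weighted_symPairing (W Z : Finset G) (hZ : ∀ y ∈ W, ∀ w ∈ W, y - w ∈ Z)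
    (S : D → G → D → G → ℝ) (tau : D → G → V →ₗ[ℝ] ℝ) (lam : D → G → V)
    (hS : ∀ (ν : D) (z : G) (κ : D) (y : G), S ν z κ y = S ν 0 κ (y - z))
    (hτ : ∀ (κ : D) (y : G) (μ : D) (z : G), tau κ y (lam μ z) = tau κ (y - z) (lam μ 0))
    (hSW : ∀ (ν κ : D) (w : G), w ∉ W → S ν 0 κ w = 0) (hτW : ∀ (κ μ : D) (w : G), w ∉ W → tau κ w (lam μ 0) = 0)
    (ω : G → ℝ) (μ ν : D) :
    HasSum (fun z : G => ω z * ∑ κ, ∑ y ∈ W, (S ν z κ y * tau κ y (lam μ 0) + S μ 0 κ y * tau κ y (lam ν z)))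
      (∑ z ∈ Z, ω z * ∑ κ, ∑ y ∈ W, (S ν z κ y * tau κ y (lam μ 0) + S μ 0 κ y * tau κ y (lam ν z))) :=
  hasSum_sum_of_ne_finset_zero fun z hz => by
    rw [symPairing_eq_zero_of_not_mem W Z hZ S tau lam hS hτ hSW hτW μ ν z hz, mul_zero]

/-- [folklore] **`hasSum_zerothMoment_symPairing`** — an4's `hD0` SHAPE on the whole group: under `hΘ`, `HasSum (z ↦ X((μ,0),(ν,z))) 0`. -/
theorem hasSum_zerothMoment_symPairing (W Z : Finset G) (hZ : ∀ y ∈ W, ∀ w ∈ W, y - w ∈ Z)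
    (S : D → G → D → G → ℝ) (tau : D → G → V →ₗ[ℝ] ℝ) (lam : D → G → V)
    (hS : ∀ (ν : D) (z : G) (κ : D) (y : G), S ν z κ y = S ν 0 κ (y - z))
    (hτ : ∀ (κ : D) (y : G) (μ : D) (z : G), tau κ y (lam μ z) = tau κ (y - z) (lam μ 0))
    (hSW : ∀ (ν κ : D) (w : G), w ∉ W → S ν 0 κ w = 0) (hτW : ∀ (κ μ : D) (w : G), w ∉ W → tau κ w (lam μ 0) = 0)
    (hΘ : ∀ (κ μ : D), ∑ y ∈ W, tau κ y (lam μ 0) = 0) (μ ν : D) :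
    HasSum (fun z : G => ∑ κ, ∑ y ∈ W, (S ν z κ y * tau κ y (lam μ 0) + S μ 0 κ y * tau κ y (lam ν z))) 0 := by
  have h := hasSum_weighted_symPairing W Z hZ S tau lam hS hτ hSW hτW (fun _ => (1 : ℝ)) μ ν
  simp only [one_mul] at h
  rwa [latticeZerothMoment_symPairing_eq_zero W Z hZ S tau lam hS hτ hSW hτW hΘ μ ν] at h

/-- [folklore] **`hasSum_firstMoment_symPairing_diag`** — an4's `hD1` SHAPE ON THE DIAGONAL SOURCE PAIRS on the whole group: under `hΘ`, for every additive
coordinate `c` and `μ = ν`, `HasSum (z ↦ c z·X((μ,0),(μ,z))) 0`. -/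
theorem hasSum_firstMoment_symPairing_diag (W Z : Finset G) (hZ : ∀ y ∈ W, ∀ w ∈ W, y - w ∈ Z)
    (S : D → G → D → G → ℝ) (tau : D → G → V →ₗ[ℝ] ℝ) (lam : D → G → V)
    (hS : ∀ (ν : D) (z : G) (κ : D) (y : G), S ν z κ y = S ν 0 κ (y - z))
    (hτ : ∀ (κ : D) (y : G) (μ : D) (z : G), tau κ y (lam μ z) = tau κ (y - z) (lam μ 0))
    (hSW : ∀ (ν κ : D) (w : G), w ∉ W → S ν 0 κ w = 0) (hτW : ∀ (κ μ : D) (w : G), w ∉ W → tau κ w (lam μ 0) = 0)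
    (hΘ : ∀ (κ μ : D), ∑ y ∈ W, tau κ y (lam μ 0) = 0) (c : G →+ ℝ) (μ : D) :
    HasSum (fun z : G => c z * ∑ κ, ∑ y ∈ W, (S μ z κ y * tau κ y (lam μ 0) + S μ 0 κ y * tau κ y (lam μ z))) 0 := by
  have h := hasSum_weighted_symPairing W Z hZ S tau lam hS hτ hSW hτW c μ μ
  rwa [latticeFirstMoment_symPairing_diag_eq_zero W Z hZ S tau lam hS hτ hSW hτW hΘ c μ] at h

end Summit.QuantumFields.BalabanUV.Beta.FP.TowerK2bDoorTadpoleMoments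

end
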